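import Mathlib
import HarnessLib

/-!
# Cassels' theorem on Catalan's equation (Schoof, *Catalan's Conjecture*, Chapter 6)

For odd primes `p, q` and non-zero integers `x, y` with `x ^ p - y ^ q = 1`, J. W. S. Cassels
(1960) proved that `q ∣ x` and `p ∣ y` [Schoof2009, Theorem 6.4], whence the `p`-adic, `q`-adic
and Archimedean structure of a solution [Schoof2009, Corollary 6.5]:
`x - 1 = p^(q-1) a^q`, `(x^p - 1)/(x - 1) = p v^q`, `y = p a v`, and symmetrically
`y + 1 = q^(p-1) b^p`, `(y^q + 1)/(y + 1) = q u^p`, `x = q u b`, with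
`|x| ≥ max (p^(q-1) - 1) (q^(p-1) + q)`. This is the first step of each of Mihăilescu's
Theorems I–IV.

This file (part 1) proves, sorry-free and with no new definitions:

* `Catalan.pow_sub_pow_ne_one` — [Schoof2009, Lemma 6.1]: `x ^ p - y ^ p ≠ 1` for odd `p ≥ 3`
  and non-zero `x, y` (so the two exponents of a solution are distinct);
* `Catalan.pow_sub_one_pow_le`, `Catalan.pow_add_one_pow_le` — [Schoof2009, Exercise 6.1] in
  integer form: `(b^q - 1)^p ≤ (b^p - 1)^q` and `(c^p + 1)^q ≤ (c^q + 1)^p` for `q ≤ p`;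
* `Catalan.dvd_of_pow_sub_pow_eq_one` — [Schoof2009, Proposition 6.2 (i)]: for odd primes
  `p > q`, `q ∣ x` (an easy instance of Runge's method: otherwise `y + 1 = b ^ p` and `x ^ p`
  would lie strictly between two consecutive `p`-th powers);
* `Catalan.descent` — the common core of [Schoof2009, Proposition 6.2 (ii) and Corollary 6.5]
  (Exercises 2.3, 3.2, 6.2): for an odd prime `ℓ`, an odd exponent `n`, `c = ±1` and integers
  with `w ^ n = z ^ ℓ - c ^ ℓ`, `ℓ ∣ w`, one has `z - c = ℓ^(n-1) b^n`,
  `(z^ℓ - c^ℓ)/(z - c) = ℓ u^n`, `w = ℓ b u` with `ℓ ∤ u`;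
* `Catalan.abs_ge_of_pow_sub_pow_eq_one` — [Schoof2009, Proposition 6.2 (ii)]: for odd primes
  `p > q`, `|x| ≥ q + q ^ (p - 1)`.

## References

* R. Schoof, *Catalan's Conjecture*, Universitext, Springer 2009 [Schoof2009], Chapter 6
  (Lemma 6.1, Proposition 6.2, Lemma 6.3, Theorem 6.4, Corollary 6.5, Exercises 6.1–6.5;
  book pp. 33–39) — held, read via `lit read book:schoof2009-catalan-s-conjecture`
  (PDF pp. 114–120).
* J. W. S. Cassels, *On the equation `a^x - b^y = 1`. II*, Proc. Cambridge Philos. Soc. **56**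
  (1960), 97–103 [Cassels1960].
-/

namespace Literature.NumberTheory.DiophantineGeometry

namespace Catalan

open Finset

/-! ### Lemma 6.1: the two exponents of a solution are distinct -/

/-- Each term of the geometric sum `∑ (y+1)^i y^(p-1-i)` is `≥ 1` for an integer `y ∉ {0, -1}`
and `p` odd: for `y ≥ 1` all factors are positive, for `y ≤ -2` the term equals
`|y+1|^i |y|^(p-1-i)` because `p - 1` is even. [folklore] -/
theorem one_le_succ_pow_mul_pow {p : ℕ} (hp : Odd p) {y : ℤ} (hy : y ≠ 0) (hy' : y ≠ -1) {i : ℕ}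
    (hi : i < p) : 1 ≤ (y + 1) ^ i * y ^ (p - 1 - i) := by
  rcases lt_or_gt_of_ne hy with hneg | hpos
  · -- `y ≤ -2`: write `y + 1 = -s`, `y = -t` with `s ≥ 1`, `t ≥ 2`
    have hy2 : y ≤ -2 := by omega
    obtain ⟨k, hk⟩ := hp
    have heven : Even (p - 1 - i + i) := by
      rw [Nat.sub_add_cancel (by omega)]
      exact ⟨k, by omega⟩
    have key : (y + 1) ^ i * y ^ (p - 1 - i) = (-(y + 1)) ^ i * (-y) ^ (p - 1 - i) := by
      rw [neg_pow, neg_pow (y)]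
      have h1 : (-1 : ℤ) ^ i * (-1) ^ (p - 1 - i) = 1 := by
        rw [← pow_add, add_comm]
        exact heven.neg_one_pow
      calc (y + 1) ^ i * y ^ (p - 1 - i)
          = ((-1 : ℤ) ^ i * (-1) ^ (p - 1 - i)) * ((y + 1) ^ i * y ^ (p - 1 - i)) := by
            rw [h1, one_mul]
        _ = (-1) ^ i * (y + 1) ^ i * ((-1) ^ (p - 1 - i) * y ^ (p - 1 - i)) := by ring
    rw [key]
    have hs : 1 ≤ -(y + 1) := by omega
    have ht : 1 ≤ -y := by omega
    exact one_le_mul_of_one_le_of_one_le (one_le_pow₀ hs) (one_le_pow₀ ht)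
  · have hs : 1 ≤ y + 1 := by omega
    have ht : 1 ≤ y := by omega
    exact one_le_mul_of_one_le_of_one_le (one_le_pow₀ hs) (one_le_pow₀ ht)

/-- **[Schoof2009, Lemma 6.1]** (the case of equal exponents). For an odd `p ≥ 3` and non-zero
integers `x, y` one has `x ^ p - y ^ p ≠ 1`: `p`-th powers are far apart — if `x ^ p = y ^ p + 1`
then `y < x`, so `(y + 1) ^ p ≤ x ^ p = y ^ p + 1`, while `(y + 1) ^ p - y ^ p ≥ p ≥ 3` unless
`y ∈ {0, -1}` (and `y = -1` forces `x = 0`). Hence the two (odd prime) exponents of a non-trivial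
solution of Catalan's equation are distinct. [cite: Schoof2009, Lemma 6.1] -/
theorem pow_sub_pow_ne_one {p : ℕ} (hp : Odd p) (hp3 : 3 ≤ p) {x y : ℤ} (hx : x ≠ 0) (hy : y ≠ 0) :
    x ^ p - y ^ p ≠ 1 := by
  intro h
  have hy' : y ≠ -1 := by
    rintro rfl
    rw [hp.neg_one_pow] at h
    have : x ^ p = 0 := by linarith
    exact hx (pow_eq_zero_iff (by omega) |>.mp this)
  have hlt : y < x := by
    rw [← hp.pow_lt_pow]
    linarith
  have hle : (y + 1) ^ p ≤ x ^ p := hp.pow_le_pow.mpr (by omega)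
  -- `(y + 1) ^ p - y ^ p = ∑_{i<p} (y+1)^i y^(p-1-i) ≥ p`
  have hgeom := geom_sum₂_mul (y + 1) y p
  rw [add_sub_cancel_left, mul_one] at hgeom
  have hsum : (p : ℤ) ≤ ∑ i ∈ range p, (y + 1) ^ i * y ^ (p - 1 - i) := by
    calc (p : ℤ) = ∑ _i ∈ range p, (1 : ℤ) := by simp
      _ ≤ ∑ i ∈ range p, (y + 1) ^ i * y ^ (p - 1 - i) :=
          sum_le_sum fun i hi => one_le_succ_pow_mul_pow hp hy hy' (mem_range.mp hi)
  rw [hgeom] at hsum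
  have : (3 : ℤ) ≤ p := by exact_mod_cast hp3
  linarith

/-! ### Exercise 6.1: the two power inequalities -/

/-- **[Schoof2009, Exercise 6.1], first inequality, integer form**: for `b ≥ 1` and `q ≤ p`,
`(b ^ q - 1) ^ p ≤ (b ^ p - 1) ^ q` (i.e. `t ↦ (b^t - 1)^(1/t)` is increasing). Proof:
`(b^q - 1)^p = (b^q - 1)^q (b^q - 1)^(p-q) ≤ (b^q - 1)^q (b^(p-q))^q = (b^p - b^(p-q))^q ≤ (b^p - 1)^q`.
[cite: Schoof2009, Exercise 6.1] -/
theorem pow_sub_one_pow_le {b : ℤ} (hb : 1 ≤ b) {p q : ℕ} (hqp : q ≤ p) :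
    (b ^ q - 1) ^ p ≤ (b ^ p - 1) ^ q := by
  have h0 : 0 ≤ b ^ q - 1 := by linarith [one_le_pow₀ (n := q) hb]
  have h1 : 1 ≤ b ^ (p - q) := one_le_pow₀ hb
  calc (b ^ q - 1) ^ p = (b ^ q - 1) ^ q * (b ^ q - 1) ^ (p - q) := by
        rw [← pow_add, Nat.add_sub_cancel' hqp]
    _ ≤ (b ^ q - 1) ^ q * (b ^ (p - q)) ^ q := by
        apply mul_le_mul_of_nonneg_left _ (pow_nonneg h0 _)
        calc (b ^ q - 1) ^ (p - q) ≤ (b ^ q) ^ (p - q) :=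
              pow_le_pow_left₀ h0 (by linarith) _
          _ = (b ^ (p - q)) ^ q := by rw [← pow_mul, ← pow_mul, mul_comm]
    _ = (b ^ p - b ^ (p - q)) ^ q := by
        rw [← mul_pow, sub_mul, ← pow_add, Nat.add_sub_cancel' hqp, one_mul]
    _ ≤ (b ^ p - 1) ^ q := pow_le_pow_left₀ (by nlinarith [pow_le_pow_right₀ hb (Nat.sub_le p q)])
        (by linarith) _

/-- **[Schoof2009, Exercise 6.1], second inequality, integer form**: for `c ≥ 1` and `q ≤ p`,
`(c ^ p + 1) ^ q ≤ (c ^ q + 1) ^ p` (i.e. `t ↦ (c^t + 1)^(1/t)` is decreasing). Proof: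
`(c^q + 1)^p = (c^q + 1)^q (c^q + 1)^(p-q) ≥ (c^q + 1)^q (c^(p-q))^q = (c^p + c^(p-q))^q ≥ (c^p + 1)^q`.
[cite: Schoof2009, Exercise 6.1] -/
theorem pow_add_one_pow_le {c : ℤ} (hc : 1 ≤ c) {p q : ℕ} (hqp : q ≤ p) :
    (c ^ p + 1) ^ q ≤ (c ^ q + 1) ^ p := by
  have h0 : 0 ≤ c ^ q := pow_nonneg (by linarith) _
  have h1 : 1 ≤ c ^ (p - q) := one_le_pow₀ hc
  calc (c ^ p + 1) ^ q ≤ (c ^ p + c ^ (p - q)) ^ q :=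
        pow_le_pow_left₀ (by positivity) (by linarith) _
    _ = (c ^ q + 1) ^ q * (c ^ (p - q)) ^ q := by
        rw [← mul_pow, add_mul, ← pow_add, Nat.add_sub_cancel' hqp, one_mul]
    _ ≤ (c ^ q + 1) ^ q * (c ^ q + 1) ^ (p - q) := by
        apply mul_le_mul_of_nonneg_left _ (pow_nonneg (by positivity) _)
        calc (c ^ (p - q)) ^ q = (c ^ q) ^ (p - q) := by rw [← pow_mul, ← pow_mul, mul_comm]
          _ ≤ (c ^ q + 1) ^ (p - q) := pow_le_pow_left₀ h0 (by linarith) _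
    _ = (c ^ q + 1) ^ p := by rw [← pow_add, Nat.add_sub_cancel' hqp]

/-! ### Proposition 6.2 (i): the smaller exponent divides `x` -/

/-- The cofactor of `y + 1` in `y ^ q + 1` for odd `q`: with
`T = ∑_{i<q} y^i (-1)^(q-1-i)` one has `T * (y + 1) = y ^ q + 1`. [folklore] -/
theorem geom_sum₂_neg_one_mul {q : ℕ} (hq : Odd q) (y : ℤ) :
    (∑ i ∈ range q, y ^ i * (-1) ^ (q - 1 - i)) * (y + 1) = y ^ q + 1 := by
  have h := geom_sum₂_mul y (-1) q
  rw [hq.neg_one_pow, sub_neg_eq_add, sub_neg_eq_add] at h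
  exact h

/-- A common divisor of `y + 1` and of the cofactor `T = (y^q + 1)/(y + 1)` divides `q`
([Schoof2009, Exercise 3.2]: `T ≡ q (mod y + 1)`). [cite: Schoof2009, Exercise 3.2] -/
theorem dvd_of_dvd_succ_of_dvd_geom_sum₂ {q : ℕ} (hq : Odd q) {y d : ℤ} (h1 : d ∣ y + 1)
    (h2 : d ∣ ∑ i ∈ range q, y ^ i * (-1) ^ (q - 1 - i)) : d ∣ (q : ℤ) := by
  have h1' : d ∣ y - (-1) := by rwa [sub_neg_eq_add]
  have := (dvd_geom_sum₂_iff_of_dvd_sub (n := q) h1').mp h2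
  obtain ⟨k, hk⟩ := hq
  rw [show q - 1 = 2 * k by omega, pow_mul, neg_one_sq, one_pow, mul_one] at this
  exact this

/-- **[Schoof2009, Proposition 6.2 (i)]** (the easy half of Cassels' theorem, a first instance
of Runge's method). Let `p > q` be odd primes and `x, y` non-zero integers with
`x ^ p - y ^ q = 1`. Then `q ∣ x`. Otherwise the coprime factors `y + 1` and
`(y ^ q + 1)/(y + 1)` of the `p`-th power `y ^ q + 1 = x ^ p` are `p`-th powers (Exercises 3.2,
2.3), `y + 1 = b ^ p`, and `x ^ p = (b ^ p - 1) ^ q + 1` lies strictly between the consecutive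
`p`-th powers `(b ^ q - 1) ^ p` and `(b ^ q) ^ p` if `b > 0`, resp. `-x` strictly between `c ^ q`
and `c ^ q + 1` with `c = -b` if `b < 0` (Exercise 6.1). [cite: Schoof2009, Proposition 6.2 (i)] -/
theorem dvd_of_pow_sub_pow_eq_one {p q : ℕ} (hp : p.Prime) (hq : q.Prime) (hpo : Odd p)
    (hqo : Odd q) (hqp : q < p) {x y : ℤ} (hx : x ≠ 0) (hy : y ≠ 0) (h : x ^ p - y ^ q = 1) :
    (q : ℤ) ∣ x := by
  by_contra hqx
  set T := ∑ i ∈ range q, y ^ i * (-1) ^ (q - 1 - i) with hT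
  have hTy : T * (y + 1) = x ^ p := by rw [geom_sum₂_neg_one_mul hqo, ← h]; ring
  have hq' : Prime (q : ℤ) := Nat.prime_iff_prime_int.mp hq
  -- `y + 1` and `T` are coprime: a common prime divides `q`, hence is `± q`, but `q ∤ x ^ p`
  have hcop : IsCoprime (y + 1) T := by
    refine isCoprime_of_prime_dvd ?_ fun r hr hr1 hr2 => ?_
    · rintro ⟨h1, -⟩
      rw [h1, mul_zero] at hTy
      exact hx (pow_eq_zero_iff hp.ne_zero |>.mp hTy.symm)
    · have hrq : r ∣ (q : ℤ) := dvd_of_dvd_succ_of_dvd_geom_sum₂ hqo hr1 hr2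
      have hassoc : Associated r (q : ℤ) :=
        (hr.dvd_prime_iff_associated hq').mp hrq
      have hqy : (q : ℤ) ∣ y + 1 := hassoc.dvd_iff_dvd_left.mp hr1
      have : (q : ℤ) ∣ x ^ p := by rw [← hTy]; exact dvd_mul_of_dvd_right hqy _
      exact hqx (hq'.dvd_of_dvd_pow this)
  obtain ⟨b, hb⟩ := Int.eq_pow_of_mul_eq_pow_odd_left hcop hpo (by rw [mul_comm]; exact hTy)
  -- so `x ^ p = (b ^ p - 1) ^ q + 1`
  have hyb : y = b ^ p - 1 := by linarith
  have hxp : x ^ p = (b ^ p - 1) ^ q + 1 := by rw [← hyb]; linarith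
  have hqp' : q ≤ p := hqp.le
  have hq1 : 1 ≤ q := hq.one_lt.le
  rcases lt_trichotomy b 0 with hbneg | rfl | hbpos
  · -- `b < 0`: with `c = -b ≥ 1` and `w = -x`, `w ^ p = (c ^ p + 1) ^ q - 1`
    set c := -b with hc
    have hc1 : 1 ≤ c := by omega
    have hbc : b = -c := by omega
    have hw : (-x) ^ p = (c ^ p + 1) ^ q - 1 := by
      rw [hpo.neg_pow, hxp, hbc, hpo.neg_pow]
      have : (-c ^ p - 1) = -(c ^ p + 1) := by ring
      rw [this, hqo.neg_pow]
      ring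
    -- `c ^ q < -x < c ^ q + 1`
    have hlow : (c ^ q) ^ p < (-x) ^ p := by
      rw [hw, ← pow_mul]
      have hcp : 1 ≤ c ^ p := one_le_pow₀ hc1
      -- `(c^p + 1)^q ≥ (c^p)^q + q (c^p)^(q-1) ≥ c^(pq) + 1`, strictly more than `c^(pq) + 1`
      have hX : ∀ {X : ℤ}, 1 ≤ X → ∀ n : ℕ, X ^ (n + 2) + 2 ≤ (X + 1) ^ (n + 2) := by
        intro X hX n
        induction n with
        | zero => norm_num; nlinarith
        | succ n ih =>
          have hXn : 1 ≤ X ^ (n + 2) := one_le_pow₀ hX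
          calc X ^ (n + 1 + 2) + 2 = X ^ (n + 2) * X + 2 := by ring
            _ ≤ (X ^ (n + 2) + 2) * (X + 1) := by nlinarith
            _ ≤ (X + 1) ^ (n + 2) * (X + 1) := by
                apply mul_le_mul_of_nonneg_right ih (by omega)
            _ = (X + 1) ^ (n + 1 + 2) := by ring
      have := hX hcp (q - 2)
      rw [Nat.sub_add_cancel hq.two_le, ← pow_mul, mul_comm p q] at this
      linarith
    have hupp : (-x) ^ p < (c ^ q + 1) ^ p := by
      rw [hw]
      have := pow_add_one_pow_le hc1 hqp'
      linarith
    rw [hpo.pow_lt_pow] at hlow hupp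
    omega
  · -- `b = 0`: `y = -1`, `x = 0`
    rw [zero_pow hp.ne_zero, zero_sub, hqo.neg_one_pow] at hxp
    exact hx (pow_eq_zero_iff hp.ne_zero |>.mp (by linarith))
  · rcases eq_or_lt_of_le (show 1 ≤ b by omega) with hb1 | hb2
    · -- `b = 1`: `y = 0`
      rw [← hb1, one_pow, sub_self] at hyb
      exact hy hyb
    · -- `b ≥ 2`: `b ^ q - 1 < x < b ^ q`
      have hb1 : 1 ≤ b := by omega
      have hlow : (b ^ q - 1) ^ p < x ^ p := by
        rw [hxp]
        have := pow_sub_one_pow_le hb1 hqp'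
        linarith
      have hupp : x ^ p < (b ^ q) ^ p := by
        rw [hxp, ← pow_mul, mul_comm, pow_mul]
        -- `(B - 1)^q + 1 < B^q` for `B = b^p ≥ 2` hmm, need `B ≥ 2` and `q ≥ 2`
        have hB : 2 ≤ b ^ p := by
          calc (2 : ℤ) ≤ b ^ 1 := by rw [pow_one]; omega
            _ ≤ b ^ p := pow_le_pow_right₀ hb1 hp.one_lt.le
        have hq2 : 2 ≤ q := hq.two_le
        -- `(B-1)^q ≤ (B-1) * B^(q-1) = B^q - B^(q-1) ≤ B^q - 2`
        set B := b ^ p with hBdef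
        have h0 : 0 ≤ B - 1 := by omega
        calc (B - 1) ^ q + 1 = (B - 1) ^ (q - 1) * (B - 1) + 1 := by
              rw [← pow_succ, Nat.sub_add_cancel (by omega)]
          _ ≤ B ^ (q - 1) * (B - 1) + 1 := by
              have := pow_le_pow_left₀ h0 (show B - 1 ≤ B by omega) (q - 1)
              nlinarith
          _ = B ^ (q - 1) * B - B ^ (q - 1) + 1 := by ring
          _ = B ^ q - B ^ (q - 1) + 1 := by rw [← pow_succ, Nat.sub_add_cancel (by omega)]
          _ < B ^ q := by
              have : 2 ≤ B ^ (q - 1) := by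
                calc (2 : ℤ) ≤ B := hB
                  _ = B ^ 1 := (pow_one B).symm
                  _ ≤ B ^ (q - 1) := pow_le_pow_right₀ (by omega) (by omega)
              linarith
      rw [hpo.pow_lt_pow] at hlow hupp
      omega

/-! ### The descent lemma: Exercises 2.3, 3.2 and 6.2 combined -/

/-- **[Schoof2009, Exercise 6.2 (a)]** in general form: `z - c` divides
`(z ^ n - c ^ n)/(z - c) - n c ^ (n - 1)`, i.e. `∑_{i<n} z^i c^(n-1-i) ≡ n c^(n-1) (mod z - c)`.
[cite: Schoof2009, Exercise 6.2] -/
theorem sub_dvd_geom_sum₂_sub_mul_pow (z c : ℤ) (n : ℕ) :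
    z - c ∣ (∑ i ∈ range n, z ^ i * c ^ (n - 1 - i)) - n * c ^ (n - 1) := by
  have h : Ideal.Quotient.mk (Ideal.span {z - c}) z = Ideal.Quotient.mk (Ideal.span {z - c}) c := by
    rw [Ideal.Quotient.eq, Ideal.mem_span_singleton]
  rw [← Ideal.mem_span_singleton, ← Ideal.Quotient.eq_zero_iff_mem, map_sub,
    RingHom.map_geom_sum₂, h, geom_sum₂_self, map_mul, map_pow, map_natCast, sub_self]

/-- **The descent lemma** — the common core of [Schoof2009, Proposition 6.2 (ii)] and
[Schoof2009, Corollary 6.5] (Exercises 2.3, 3.2, 6.2 (b)). Let `ℓ` be an odd prime, `n` an odd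
exponent, `c = ±1`, and `w, z` integers with `w ^ n = z ^ ℓ - c ^ ℓ` and `ℓ ∣ w`. Then
`z ≡ c (mod ℓ)` (Fermat), the cofactor `S = (z ^ ℓ - c ^ ℓ)/(z - c)` is `≡ ℓ (mod ℓ²)`
(Exercise 6.2 (b)), so `ℓ ∥ S` and `ℓ ^ (n-1) ∣ z - c`; the coprime integers `(z - c)/ℓ^(n-1)`
and `S/ℓ` have product the `n`-th power `(w/ℓ)^n`, hence (Exercise 2.3, `n` odd) there are
`b, u ∈ ℤ` with `z - c = ℓ ^ (n-1) b ^ n`, `S = ℓ u ^ n`, `w = ℓ b u`, and `ℓ ∤ u`.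
[cite: Schoof2009, Corollary 6.5 (proof)] -/
theorem descent {ℓ n : ℕ} (hℓ : ℓ.Prime) (hℓo : Odd ℓ) (hn : Odd n) {z c w : ℤ}
    (hc : c = 1 ∨ c = -1) (hw : (ℓ : ℤ) ∣ w) (h : w ^ n = z ^ ℓ - c ^ ℓ) :
    ∃ b u : ℤ, z - c = ℓ ^ (n - 1) * b ^ n ∧
      (∑ i ∈ range ℓ, z ^ i * c ^ (ℓ - 1 - i)) = ℓ * u ^ n ∧ w = ℓ * b * u ∧ ¬ (ℓ : ℤ) ∣ u := by
  set S := ∑ i ∈ range ℓ, z ^ i * c ^ (ℓ - 1 - i) with hS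
  have hSz : S * (z - c) = z ^ ℓ - c ^ ℓ := geom_sum₂_mul z c ℓ
  have hℓ' : Prime (ℓ : ℤ) := Nat.prime_iff_prime_int.mp hℓ
  have hℓ0 : (ℓ : ℤ) ≠ 0 := by exact_mod_cast hℓ.ne_zero
  have hn0 : n ≠ 0 := fun h0 => by simp [h0] at hn
  have hc1 : c ^ (ℓ - 1) = 1 := by
    obtain ⟨k, hk⟩ := hℓo
    rw [show ℓ - 1 = 2 * k by omega, pow_mul]
    rcases hc with rfl | rfl <;> simp
  have hcu : ¬ (ℓ : ℤ) ∣ c := by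
    intro hd
    refine hℓ'.not_unit (isUnit_of_dvd_one ?_)
    rcases hc with rfl | rfl
    · exact hd
    · exact (dvd_neg.mpr hd).trans (by norm_num)
  -- Step 1 (Fermat): `ℓ ∣ z - c`
  have hzc : (ℓ : ℤ) ∣ z - c := by
    have h1 : (ℓ : ℤ) ∣ z ^ ℓ - c ^ ℓ := by rw [← h]; exact dvd_pow hw hn0
    haveI := Fact.mk hℓ
    rw [← ZMod.intCast_zmod_eq_zero_iff_dvd] at h1 ⊢
    push_cast at h1 ⊢
    rwa [ZMod.pow_card, ZMod.pow_card] at h1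
  -- Step 2 (Exercise 6.2 (b)): `ℓ² ∣ S - ℓ`, so `S = ℓ S'` with `S' ≡ 1 (mod ℓ)`
  obtain ⟨t, ht⟩ := hzc
  have hS2 : (ℓ : ℤ) ^ 2 ∣ S - ℓ := by
    have := odd_sq_dvd_geom_sum₂_sub (R := ℤ) c t hℓo
    rw [show c + (ℓ : ℤ) * t = z by linarith, hc1, mul_one] at this
    exact this
  obtain ⟨s, hs⟩ := hS2
  set S' := 1 + ℓ * s with hS'
  have hSS' : S = ℓ * S' := by rw [hS']; linear_combination hs
  have hS'ℓ : ¬ (ℓ : ℤ) ∣ S' := by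
    rintro ⟨e, he⟩
    refine hℓ'.not_unit (isUnit_of_dvd_one ⟨e - s, ?_⟩)
    linear_combination he
  -- Step 3: `w = ℓ w'`, `ℓ^(n-1) w'^n = (z - c) S'`
  obtain ⟨w', rfl⟩ := hw
  have h3 : (ℓ : ℤ) ^ (n - 1) * w' ^ n = (z - c) * S' := by
    have h' : (ℓ : ℤ) * ((ℓ : ℤ) ^ (n - 1) * w' ^ n) = ℓ * ((z - c) * S') := by
      calc (ℓ : ℤ) * ((ℓ : ℤ) ^ (n - 1) * w' ^ n) = ((ℓ : ℤ) * w') ^ n := by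
            rw [mul_pow, ← mul_assoc, ← pow_succ', Nat.sub_add_cancel (Nat.pos_of_ne_zero hn0)]
        _ = S * (z - c) := by rw [h, hSz]
        _ = ℓ * ((z - c) * S') := by rw [hSS']; ring
    exact mul_left_cancel₀ hℓ0 h'
  -- Step 4: `ℓ^(n-1) ∣ z - c`
  have hcopℓ : IsCoprime ((ℓ : ℤ) ^ (n - 1)) S' :=
    ((Prime.coprime_iff_not_dvd hℓ').mpr hS'ℓ).pow_left
  obtain ⟨d, hd⟩ : (ℓ : ℤ) ^ (n - 1) ∣ z - c :=
    hcopℓ.dvd_of_dvd_mul_right ⟨w' ^ n, by rw [← h3]⟩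
  -- Step 5: `w'^n = d S'` with `d, S'` coprime
  have h5 : d * S' = w' ^ n := by
    have : (ℓ : ℤ) ^ (n - 1) * w' ^ n = (ℓ : ℤ) ^ (n - 1) * (d * S') := by rw [h3, hd]; ring
    exact (mul_left_cancel₀ (pow_ne_zero _ hℓ0) this).symm
  have hcop : IsCoprime d S' := by
    refine isCoprime_of_prime_dvd ?_ fun r hr hrd hrS' => ?_
    · rintro ⟨-, h0⟩
      exact hS'ℓ (h0 ▸ dvd_zero _)
    · have hr1 : r ∣ z - c := hd ▸ dvd_mul_of_dvd_right hrd _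
      have hr2 : r ∣ S := hSS' ▸ dvd_mul_of_dvd_right hrS' _
      have hr3 : r ∣ (ℓ : ℤ) * c ^ (ℓ - 1) := (dvd_geom_sum₂_iff_of_dvd_sub hr1).mp hr2
      rw [hc1, mul_one] at hr3
      have hassoc : Associated r (ℓ : ℤ) := (hr.dvd_prime_iff_associated hℓ').mp hr3
      exact hS'ℓ (hassoc.dvd_iff_dvd_left.mp hrS')
  -- Step 6: `d = b^n`, `S' = u^n`, `w' = b u`
  obtain ⟨⟨b, hb⟩, ⟨u, hu⟩⟩ := Int.eq_pow_of_mul_eq_pow_odd hcop hn h5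
  have hw' : w' = b * u := by
    rw [← hn.pow_inj, mul_pow, ← hb, ← hu, h5]
  refine ⟨b, u, by rw [hd, hb], by rw [← hu]; exact hSS', by rw [hw', mul_assoc], fun hℓu => ?_⟩
  exact hS'ℓ (hu ▸ dvd_pow hℓu hn0)

/-! ### Proposition 6.2 (ii): `|x| ≥ q + q^(p-1)` -/

/-- In `(ℤ/q^(p-2))ˣ`-terms: for odd primes `p > q` and an integer `u` with
`u ^ p ≡ 1 (mod q ^ (p-2))` one has `u ≡ 1 (mod q ^ (p-2))`, because `p` is prime to the order
`q^(p-3) (q-1)` of the unit group. [cite: Schoof2009, Proposition 6.2 (ii) (proof)] -/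
theorem modEq_one_of_pow_modEq_one {p q : ℕ} (hp : p.Prime) (hq : q.Prime) (hqp : q < p) {u : ℤ}
    (h : (q : ℤ) ^ (p - 2) ∣ u ^ p - 1) : (q : ℤ) ^ (p - 2) ∣ u - 1 := by
  have hp2 : 0 < p - 2 := by
    have := hq.two_le
    omega
  set N := q ^ (p - 2) with hN
  haveI : NeZero N := ⟨pow_ne_zero _ hq.ne_zero⟩
  have hcast : ((q : ℤ) ^ (p - 2)) = (N : ℤ) := by rw [hN]; push_cast; rfl
  rw [hcast, ← ZMod.intCast_zmod_eq_zero_iff_dvd] at h ⊢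
  push_cast at h ⊢
  rw [sub_eq_zero] at h ⊢
  -- `u` is a unit of `ZMod N` of order dividing `gcd (p, φ N) = 1`
  have hunit : IsUnit ((u : ZMod N)) := IsUnit.of_pow_eq_one h hp.ne_zero
  obtain ⟨U, hU⟩ := hunit
  have hUp : U ^ p = 1 := by
    ext
    rw [Units.val_pow_eq_pow_val, hU, h, Units.val_one]
  have hUφ : U ^ Nat.totient N = 1 := ZMod.pow_totient U
  have hgcd : p.gcd (Nat.totient N) = 1 := by
    rw [hN, Nat.totient_prime_pow hq hp2]
    have h1 : Nat.Coprime p (q ^ (p - 2 - 1)) :=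
      ((Nat.coprime_primes hp hq).mpr hqp.ne').pow_right _
    have hq2 := hq.two_le
    have hlt : q - 1 < p := by omega
    have h2 : Nat.Coprime p (q - 1) := Nat.coprime_of_lt_prime (by omega) hlt hp
    exact Nat.Coprime.mul_right h1 h2
  have hU1 : U ^ (p.gcd (Nat.totient N)) = 1 := pow_gcd_eq_one.mpr ⟨hUp, hUφ⟩
  rw [hgcd, pow_one] at hU1
  rw [← hU, hU1, Units.val_one]

/-- **[Schoof2009, Proposition 6.2 (ii)]**. Let `p > q` be odd primes and `x, y` non-zero
integers with `x ^ p - y ^ q = 1`. Then `|x| ≥ q + q ^ (p - 1)`. By part (i) `q ∣ x`; the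
descent lemma gives `y + 1 = q^(p-1) b^p`, `(y^q + 1)/(y + 1) = q u^p`, `x = q b u`; since
`(y^q+1)/(y+1) ≡ q (mod y + 1)` one gets `u ^ p ≡ 1 (mod q^(p-2))`, hence `u ≡ 1 (mod q^(p-2))`
(`p` is prime to `q^(p-3)(q-1)`); `u > 0` and `u ≠ 1` (else `(y^q+1)/(y+1) = q` with
`|y + 1| ≥ q^(p-1)`, absurd), so `u ≥ 1 + q^(p-2)` and `|x| = q |b| u ≥ q + q^(p-1)`.
[cite: Schoof2009, Proposition 6.2 (ii)] -/
theorem abs_ge_of_pow_sub_pow_eq_one {p q : ℕ} (hp : p.Prime) (hq : q.Prime) (hpo : Odd p)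
    (hqo : Odd q) (hqp : q < p) {x y : ℤ} (hx : x ≠ 0) (hy : y ≠ 0) (h : x ^ p - y ^ q = 1) :
    (q : ℤ) + (q : ℤ) ^ (p - 1) ≤ |x| := by
  have hqx : (q : ℤ) ∣ x := dvd_of_pow_sub_pow_eq_one hp hq hpo hqo hqp hx hy h
  have hq0 : (q : ℤ) ≠ 0 := by exact_mod_cast hq.ne_zero
  have hq3 : (3 : ℤ) ≤ q := by
    have := hq.two_le
    obtain ⟨k, hk⟩ := hqo
    omega
  have hp5 : 5 ≤ p := by
    have := hq.two_le
    obtain ⟨k, hk⟩ := hpo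
    obtain ⟨j, hj⟩ := hqo
    omega
  -- the descent lemma with `ℓ = q`, `n = p`, `z = y`, `c = -1`, `w = x`
  have h' : x ^ p = y ^ q - (-1) ^ q := by rw [hqo.neg_one_pow]; linarith
  obtain ⟨b, u, hb, hT, hxbu, hqu⟩ := descent hq hqo hpo (Or.inr rfl) hqx h'
  rw [sub_neg_eq_add] at hb
  set T := ∑ i ∈ range q, y ^ i * (-1) ^ (q - 1 - i) with hTdef
  have hTy : T * (y + 1) = y ^ q + 1 := geom_sum₂_neg_one_mul hqo y
  have hy1 : y + 1 ≠ 0 := by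
    intro h0
    have : y = -1 := by linarith
    rw [this, hqo.neg_one_pow] at h
    exact hx (pow_eq_zero_iff hp.ne_zero |>.mp (by linarith))
  have hb0 : b ≠ 0 := by
    rintro rfl
    rw [zero_pow hp.ne_zero, mul_zero] at hb
    exact hy1 hb
  -- `u ^ p ≡ 1 (mod q^(p-2))`, hence `u ≡ 1 (mod q^(p-2))`
  have hneg1 : (-1 : ℤ) ^ (q - 1) = 1 := by
    obtain ⟨k, hk⟩ := hqo
    rw [show q - 1 = 2 * k by omega, pow_mul, neg_one_sq, one_pow]
  have hTmod : y + 1 ∣ T - q := by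
    have := sub_dvd_geom_sum₂_sub_mul_pow y (-1) q
    rw [sub_neg_eq_add, hneg1, mul_one] at this
    exact this
  have hup : (q : ℤ) ^ (p - 2) ∣ u ^ p - 1 := by
    have h1 : (q : ℤ) ^ (p - 1) ∣ (q : ℤ) * (u ^ p - 1) := by
      have : (q : ℤ) ^ (p - 1) ∣ T - q := (Dvd.intro _ hb.symm).trans hTmod
      rw [hT] at this
      convert this using 1
      ring
    rw [show p - 1 = p - 2 + 1 by omega, pow_succ, mul_comm] at h1
    exact (mul_dvd_mul_iff_left hq0).mp h1
  have hu1 : (q : ℤ) ^ (p - 2) ∣ u - 1 := modEq_one_of_pow_modEq_one hp hq hqp hup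
  -- `T > 0`, hence `u > 0`
  have hTpos : 0 < T := by
    rcases lt_or_gt_of_ne hy1 with hneg | hpos
    · have hyq : y ^ q + 1 < 0 := by
        have h2 : 2 ≤ -y := by omega
        have : (2 : ℤ) ^ q ≤ (-y) ^ q := pow_le_pow_left₀ (by norm_num) h2 q
        rw [hqo.neg_pow] at this
        have : (2 : ℤ) ≤ 2 ^ q := by
          calc (2 : ℤ) = 2 ^ 1 := by norm_num
            _ ≤ 2 ^ q := pow_le_pow_right₀ (by norm_num) hq.one_lt.le
        linarith
      exact pos_of_mul_neg_left (by rw [hTy]; exact hyq) hneg.le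
    · have hyq : 0 < y ^ q + 1 := by
        have : 0 ≤ y ^ q := pow_nonneg (by omega) q
        linarith
      exact pos_of_mul_pos_left (by rw [hTy]; exact hyq) hpos.le
  have hupos : 0 < u := by
    rw [← hpo.pow_pos_iff]
    have : 0 < (q : ℤ) * u ^ p := by rw [← hT]; exact hTpos
    exact pos_of_mul_pos_right this (by positivity)
  -- `u ≠ 1`: otherwise `T = q` while `|y + 1| ≥ q ^ (p - 1) ≥ q ^ 2`
  have hq2y : (q : ℤ) ^ 2 ≤ |y + 1| := by
    rw [hb, abs_mul, abs_pow, abs_pow, Nat.abs_cast]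
    calc (q : ℤ) ^ 2 ≤ (q : ℤ) ^ (p - 1) := pow_le_pow_right₀ (by linarith) (by omega)
      _ = (q : ℤ) ^ (p - 1) * 1 := (mul_one _).symm
      _ ≤ (q : ℤ) ^ (p - 1) * |b| ^ p :=
          mul_le_mul_of_nonneg_left (one_le_pow₀ (Int.one_le_abs hb0)) (by positivity)
  have hune : u ≠ 1 := by
    rintro rfl
    rw [one_pow, mul_one] at hT
    -- `T = q`, `T (y + 1) = y ^ q + 1`
    have hq1 : (q : ℤ) ≤ (q : ℤ) ^ 2 := by nlinarith
    rcases lt_or_gt_of_ne hy1 with hneg | hpos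
    · -- `y ≤ -2`: with `Y = -y`, `Y ^ q - 1 = q (Y - 1)` forces `Y + 1 ≤ q`, but `Y - 1 ≥ q²`
      obtain ⟨Y, rfl⟩ : ∃ Y, y = -Y := ⟨-y, (neg_neg y).symm⟩
      have hY1 : (q : ℤ) ^ 2 ≤ Y - 1 := by
        rwa [show -Y + 1 = -(Y - 1) by ring, abs_neg, abs_of_pos (by omega)] at hq2y
      have hYq : Y ^ q - 1 = q * (Y - 1) := by
        have := hTy
        rw [hT, hqo.neg_pow] at this
        linear_combination this
      have hY2 : Y ^ 2 ≤ Y ^ q := pow_le_pow_right₀ (by nlinarith) hq.two_le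
      have h3 : (Y - 1) * (Y + 1) ≤ (Y - 1) * q := by nlinarith
      have h4 : Y + 1 ≤ q := le_of_mul_le_mul_left h3 (by nlinarith)
      nlinarith
    · -- `y ≥ 0`: `y ^ q + 1 = q (y + 1) ≤ (y + 1)²` but `y ^ q ≥ y ^ 3`
      have hyq1 : (q : ℤ) ^ 2 ≤ y + 1 := by rwa [abs_of_pos hpos] at hq2y
      have hy8 : 8 ≤ y := by nlinarith
      have hy3 : y ^ 3 ≤ y ^ q := pow_le_pow_right₀ (by omega) (by
        have := hq.two_le
        obtain ⟨k, hk⟩ := hqo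
        omega)
      have := hTy
      rw [hT] at this
      have h1 : (q : ℤ) * (y + 1) ≤ (y + 1) ^ 2 := by nlinarith
      have h2 : y ^ 3 + 1 ≤ (y + 1) ^ 2 := by nlinarith
      nlinarith [mul_pos (mul_pos (by omega : (0 : ℤ) < y) (by omega : (0 : ℤ) < y - 2))
        (by omega : (0 : ℤ) < y + 1)]
  -- so `u ≥ 1 + q ^ (p - 2)` and `|x| = q |b| u ≥ q (1 + q ^ (p - 2))`
  have hule : (q : ℤ) ^ (p - 2) ≤ u - 1 := Int.le_of_dvd (by omega) hu1
  rw [hxbu, abs_mul, abs_mul, Nat.abs_cast, abs_of_pos hupos]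
  calc (q : ℤ) + (q : ℤ) ^ (p - 1) = q * 1 * (1 + q ^ (p - 2)) := by
        rw [show p - 1 = p - 2 + 1 by omega, pow_succ]
        ring
    _ ≤ q * |b| * u := by
        apply mul_le_mul (mul_le_mul_of_nonneg_left (Int.one_le_abs hb0) (by positivity))
          (by linarith) (by positivity) (by positivity)

end Catalan

end Literature.NumberTheory.DiophantineGeometry
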